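import Literature.NumberTheory.DiophantineGeometry.MultiplicativeGroupApproximationProofs
import HarnessLib

/-!
# Cell abc-stewartyu — draft route `YuMatveevShapeRat` (plan-m3 g2): shared preliminaries of the SHAPE-form
# dependence-removal files (`ArchShapeDepElim`, `PadicShapeDepElimOdd`, `PadicShapeDepElimTwo`)

Cell `abc-stewartyu` (HOME `run/shared/lean/pub/abc-stewartyu/`; seat `lit-abc-yu2007` g3). Theorems only; no
definition, no named fact, nothing closed. Book-keeping on the index types `{k // k ≠ j}`, the size of a
small multiplicative relation (`relation_bounds`: `|2tⱼ| ≤ Rⱼ = 2∏_{l∈S∖j} 3A_l`, `|2tₖ|Aₖ ≤ RⱼAⱼ`), the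
product estimate `∏_{l∈T} 3A_l ≤ 3^{#U} ∏_{l∈U} A_l` under the floor `A ≥ 1`, the numerical inequality
`6(m+1)3^m ≤ C^{m+1}` (`C ≥ 20`), the choice of the index to eliminate, `|x| ≤ e^W` from
`log max(3,|x|) ≤ W`, and the `p`-adic Liouville estimate
`ord_p(∏ θₖ^{bₖ} − 1) log p ≤ log 2 + ∑ |bₖ| h(θₖ)` (`padicValRat_mul_log_le_logHeight₁`,
`logHeight₁_one_sub_le`). References: [Matveev2000] Izv. Math. 64 (2000) 1217–1269, §21 (p. 175);
[EvertseGyory2015] §4.4 (p. 80).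
-/

open Height Real Finset
open Literature.NumberTheory.DiophantineGeometry.Dioph

noncomputable section

namespace Summit.ABC.StewartYu

namespace ShapeDepElim


/-- Products over `{k // k ≠ j}` are products over `univ.erase j`. [folklore] -/
theorem prod_subtype_ne {κ M : Type} [Fintype κ] [DecidableEq κ] [CommMonoid M] (j : κ) (f : κ → M) :
    ∏ k : {k // k ≠ j}, f k.val = ∏ k ∈ univ.erase j, f k :=
  (Finset.prod_subtype (univ.erase j) (p := fun k => k ≠ j) (fun k => by simp) f).symm

/-- `#{k // k ≠ j} = #κ − 1`. [folklore] -/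
theorem card_subtype_ne {κ : Type} [Fintype κ] [DecidableEq κ] (j : κ) {m : ℕ}
    (hcard : Fintype.card κ = m + 1) : Fintype.card {k // k ≠ j} = m := by
  rw [Fintype.card_of_subtype (univ.erase j) (fun k => by simp), Finset.card_erase_of_mem
    (mem_univ j), card_univ, hcard]
  rfl

/-- With `Rⱼ = 2 ∏_{l ∈ S∖j} 3A_l` (`j ∈ S`, `h(a_l) ≤ A_l`): `|2tⱼ| ≤ Rⱼ` and `|2tₖ| Aₖ ≤ Rⱼ Aⱼ` for
`k ∈ S`, for a relation with `|tₖ| ≤ ∏_{l∈S∖k} 2h(a_l)/log 2`. [cite: Matveev2000, §21 (p. 175)] -/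
theorem relation_bounds {κ : Type} [Fintype κ] [DecidableEq κ] {a : κ → ℚ} {A : κ → ℝ}
    (hAh : ∀ k, logHeight₁ (a k) ≤ A k) {S : Finset κ} {t : κ → ℤ}
    (hbd : ∀ k ∈ S, (|t k| : ℝ) ≤ ∏ l ∈ S.erase k, (2 * logHeight₁ (a l) / Real.log 2))
    {j : κ} (hj : j ∈ S) :
    |((2 * t j : ℤ) : ℝ)| ≤ 2 * ∏ l ∈ S.erase j, (3 * A l) ∧
      ∀ k ∈ S, |((2 * t k : ℤ) : ℝ)| * A k ≤ (2 * ∏ l ∈ S.erase j, (3 * A l)) * A j := by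
  have hl2 : (2 : ℝ) / 3 ≤ Real.log 2 := by have := Real.log_two_gt_d9; linarith
  have hl0 : 0 < Real.log 2 := by linarith
  have hc0 : ∀ l, 0 ≤ 2 * logHeight₁ (a l) / Real.log 2 := fun l =>
    div_nonneg (mul_nonneg zero_le_two (Height.zero_le_logHeight₁ _)) hl0.le
  have hc3 : ∀ l, 2 * logHeight₁ (a l) / Real.log 2 ≤ 3 * A l := fun l => by
    rw [div_le_iff₀ hl0]; nlinarith [hAh l, Height.zero_le_logHeight₁ (a l)]
  have hA0 : ∀ l, 0 ≤ A l := fun l => le_trans (Height.zero_le_logHeight₁ _) (hAh l)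
  have hprod : ∀ k ∈ S, (|t k| : ℝ) ≤ ∏ l ∈ S.erase k, (3 * A l) := fun k hk =>
    le_trans (hbd k hk) (Finset.prod_le_prod (fun l _ => hc0 l) fun l _ => hc3 l)
  have habs : ∀ k, |((2 * t k : ℤ) : ℝ)| = 2 * |(t k : ℝ)| := by
    intro k; push_cast; rw [abs_mul, abs_two]
  refine ⟨?_, fun k hk => ?_⟩
  · rw [habs]; linarith [hprod j hj]
  · have e1 := Finset.mul_prod_erase S (fun l => 3 * A l) hk
    have e2 := Finset.mul_prod_erase S (fun l => 3 * A l) hj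
    rw [habs]
    calc 2 * |(t k : ℝ)| * A k ≤ 2 * (∏ l ∈ S.erase k, (3 * A l)) * A k := by
          have := hprod k hk; have := hA0 k; nlinarith
      _ = 2 / 3 * ((3 * A k) * ∏ l ∈ S.erase k, (3 * A l)) := by ring
      _ = 2 / 3 * ((3 * A j) * ∏ l ∈ S.erase j, (3 * A l)) := by rw [e1, e2]
      _ = (2 * ∏ l ∈ S.erase j, (3 * A l)) * A j := by ring

/-- Under the floor `A_l ≥ 1`: `∏_{l∈T} 3A_l ≤ 3^{#U} ∏_{l∈U} A_l` for `T ⊆ U`. [folklore] -/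
theorem prod_three_mul_le {κ : Type} [DecidableEq κ] {A : κ → ℝ} (hA1 : ∀ k, (1 : ℝ) ≤ A k)
    {T U : Finset κ} (hTU : T ⊆ U) :
    ∏ l ∈ T, (3 * A l) ≤ (3 : ℝ) ^ U.card * ∏ l ∈ U, A l := by
  rw [← Finset.inter_eq_right.mpr hTU, ← Finset.prod_ite_mem U T (fun l => 3 * A l)]
  rw [← Finset.prod_const, ← Finset.prod_mul_distrib]
  refine Finset.prod_le_prod (fun l _ => ?_) (fun l _ => ?_)
  · split_ifs
    · linarith [hA1 l]
    · exact zero_le_one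
  · split_ifs
    · linarith [hA1 l]
    · linarith [hA1 l]

/-- `6 (m+1) 3^m ≤ C^{m+1}` for `C ≥ 20`. [folklore] -/
theorem six_mul_three_pow_le {C : ℝ} (hC : 20 ≤ C) (m : ℕ) :
    6 * ((m : ℝ) + 1) * (3 : ℝ) ^ m ≤ C ^ (m + 1) := by
  have h1 : ((m : ℝ) + 1) ≤ (2 : ℝ) ^ m := by
    have : (m + 1 : ℕ) ≤ 2 ^ m := Nat.succ_le_of_lt (Nat.lt_two_pow_self)
    exact_mod_cast this
  have h3 : 0 ≤ (3 : ℝ) ^ m := by positivity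
  have h6 : (2 : ℝ) ^ m * 3 ^ m = 6 ^ m := by rw [← mul_pow]; norm_num
  have hC6 : (6 : ℝ) ^ m ≤ C ^ m := pow_le_pow_left₀ (by norm_num) (by linarith) m
  have hCm : 0 ≤ C ^ m := by positivity
  calc 6 * ((m : ℝ) + 1) * 3 ^ m ≤ 6 * 2 ^ m * 3 ^ m := by nlinarith
    _ = 6 * 6 ^ m := by rw [mul_assoc, h6]
    _ ≤ C * C ^ m := by nlinarith
    _ = C ^ (m + 1) := by ring

/-- The choice of the index to eliminate: `k*` if it lies in the support `S`, else any index of `S`;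
either way `S ∖ j ⊆ κ ∖ k*`. [folklore] -/
theorem exists_elim_index {κ : Type} [Fintype κ] [DecidableEq κ] {S : Finset κ} (hSne : S.Nonempty)
    (ks : κ) : ∃ j ∈ S, S.erase j ⊆ univ.erase ks := by
  by_cases hks : ks ∈ S
  · exact ⟨ks, hks, Finset.erase_subset_erase ks (subset_univ S)⟩
  · obtain ⟨j, hj⟩ := hSne
    exact ⟨j, hj, fun l hl => Finset.mem_erase.mpr ⟨fun h => hks (h ▸ (Finset.mem_erase.mp hl).2),
      mem_univ l⟩⟩

/-- `|x| ≤ e^W` when `log max(3,|x|) ≤ W`. [folklore] -/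
theorem abs_le_exp_of_log_max_le {x W : ℝ} (h : Real.log (max 3 |x|) ≤ W) : |x| ≤ Real.exp W := by
  have h0 : 0 < max 3 |x| := lt_of_lt_of_le (by norm_num) (le_max_left _ _)
  calc |x| ≤ max 3 |x| := le_max_right _ _
    _ = Real.exp (Real.log (max 3 |x|)) := (Real.exp_log h0).symm
    _ ≤ Real.exp W := Real.exp_le_exp.mpr h

/-- The `p`-adic Liouville estimate: `ord_p(∏ θₖ^{bₖ} − 1) log p ≤ log 2 + ∑ |bₖ| h(θₖ)` when the
product is `≠ 1`. [cite: EvertseGyory2015, §4.4 (p. 80)] -/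
theorem padic_liouville {κ : Type} [Fintype κ] {p : ℕ} (hp : p.Prime) (θ : κ → ℚ) (b : κ → ℤ)
    (hΞ : ∏ k, θ k ^ b k ≠ 1) :
    (padicValRat p (∏ k, θ k ^ b k - 1) : ℝ) * Real.log p ≤
      Real.log 2 + ∑ k, |(b k : ℝ)| * logHeight₁ (θ k) := by
  set Ξ := ∏ k, θ k ^ b k with hΞdef
  have hz : 1 - Ξ ≠ 0 := sub_ne_zero.mpr (Ne.symm hΞ)
  rw [show Ξ - 1 = -(1 - Ξ) by ring, padicValRat.neg]
  have h1 := padicValRat_mul_log_le_logHeight₁ p hp hz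
  have h2 := logHeight₁_one_sub_le Ξ
  have h3 : logHeight₁ Ξ ≤ ∑ k, |(b k : ℝ)| * logHeight₁ (θ k) := by
    rw [hΞdef]
    refine le_trans (logHeight₁_prod_le _ _) (Finset.sum_le_sum fun k _ => ?_)
    rw [logHeight₁_zpow, Nat.cast_natAbs, Int.cast_abs]
  linarith

end ShapeDepElim

end Summit.ABC.StewartYu

end
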